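import Mathlib
import HarnessLib

/-!
# Crux `TropicalWeilVanishing` (stmt-HodgeConjecture-18478) — the moment identity at a CROSSING of two sheets:
# tears lie in the plane of the normals and are coupled (`w₁ a = w₂ c`); nothing forces concurrency

Route `TropicalWeilObstruction` of `HodgeConjecture`; cell `pub-hodge-tropical` (Hodge NEGATION SINK — scoped exploration,
cap 2 seats, no summit claim), seat tropical-2 gen 14 (`prover-pub-hodge-tropical-2-g14-0`, 2026-08-23), written while
REFEREEING the open point of remark R-R6 on tropical-1's `certificates/splitrigidity/` (Theorem R): what the local first-order
analysis gives at a FOUR-VALENT face. HONEST FRAMING: elementary linear algebra over a field, valid in a vector space of any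
dimension; it is the algebra inside one step of a paper argument about configurations at NON-generic split periods; it decides
nothing about K1 (`TropicalWeilVanishing`, OPEN) or K1_∂ (OPEN) and nothing here bears on the Hodge conjecture.
negation-sink work.

Setting (HOME `certificates/splitrigidity/README.md` §4, §10 (P5), §11; REFEREE-K1K2.md, tropical-2 gen 14 addendum 2). At a
codimension-one face of a degenerating constant-type family of effective tropical cycles the rescaled limit is, modulo the
direction of the face, a finite balanced weighted graph with ENDS; its ends balance and their total MOMENT
`Σ_h w_h β(a_h, n_h)` vanishes for every alternating bilinear `β` (tree: `SplitRigidity.moment_identity`,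
`Junction.sum_ends_smul_moment_eq_zero`). At a TRIVALENT face this forces the three averaged sheets to stay concurrent
(`SplitRigidity.third_line_moment_eq_zero`, `Junction.form_sub_eq_zero_of_moment`). At a CROSSING — two sheets with
normals `±n₁` and `±n₂` meeting along the face, the only other local shape a complete-intersection monomial of theta divisors can
have (non-triangular Delaunay 2-faces are rectangles) — the same identity gives exactly:
* `eq_and_eq_of_pair_balance` — balancing `w₁n₁ + w₂n₂ − w₃n₁ − w₄n₂ = 0` with `n₁, n₂` independent forces equal weights on
  the two halves of each sheet (`w₁ = w₃`, `w₂ = w₄`);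
* `crossing_moment_eq` — the four-end moment is `w₁ β(t₁, n₁) + w₂ β(t₂, n₂)` with the TEARS `t₁ = a₁ − a₃`, `t₂ = a₂ − a₄`
  (relative displacement of the two halves of a sheet);
* `mem_span_pair_of_crossing_moment` — if that vanishes for every alternating `β`, each tear lies in the plane `K n₁ + K n₂`
  of the normals ("tear vectors lie in the sum of the two spans", §10 (P5)(i));
* `mul_eq_mul_of_crossing_moment` — and writing `t₁ ≡ a n₂ (mod n₁)`, `t₂ ≡ c n₁ (mod n₂)` the tears are COUPLED:
  `w₁ a = w₂ c` (the node-resolution coupling `W_P β = W_{P′} γ`, §10 (P5)(ii)); `crossing_moment_of_coupled` — conversely every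
  coupled pair of in-plane tears has zero moment, so the moment identity imposes nothing more: in particular NO concurrency and no
  relation between the transverse offsets of the two sheets, which is why Theorem R's sheet-averaging does not extend verbatim to
  crossings (REFEREE-K1K2.md, addendum 2 to the splitrigidity verdict).
Mathlib only; nothing is defined; no named fact; no sorry.

## References

* [Zharkov2020TropicalWeil] I. Zharkov, Tropical abelian varieties, Weil classes and the Hodge conjecture, arXiv:2002.02347
  (2020), p. 2 (balanced weighted polyhedral complexes = tropical cycles).
* [MikhalkinZharkov2014Eigenwave] G. Mikhalkin, I. Zharkov, Tropical eigenwave and intermediate Jacobians, LN UMI 15 (2014),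
  Def. 4.2, Prop. 4.3 (balancing condition).
-/

set_option linter.dupNamespace false

namespace Summit.HodgeConjecture.HodgeConjecture.Theorems.TropicalWeilVanishing.SplitRigidity.Crossing

variable {K : Type*} [Field K] {V : Type*} [AddCommGroup V] [Module K V]

/-- **Balancing at a crossing forces equal weights on the two halves of each sheet.** If
`w₁ • n₁ + w₂ • n₂ - w₃ • n₁ - w₄ • n₂ = 0` (the four half-sheets at a crossing, outward normals `n₁, n₂, -n₁, -n₂`)
and `n₁, n₂` are linearly independent, then `w₁ = w₃` and `w₂ = w₄`. [folklore] -/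
theorem eq_and_eq_of_pair_balance (n₁ n₂ : V) (hn : LinearIndependent K ![n₁, n₂]) (w₁ w₂ w₃ w₄ : K)
    (hbal : w₁ • n₁ + w₂ • n₂ - w₃ • n₁ - w₄ • n₂ = 0) : w₁ = w₃ ∧ w₂ = w₄ := by
  have h : (w₁ - w₃) • n₁ + (w₂ - w₄) • n₂ = 0 := by
    rw [sub_smul, sub_smul, ← hbal]; abel
  obtain ⟨h₁, h₂⟩ := (LinearIndependent.pair_iff.mp hn) _ _ h
  exact ⟨sub_eq_zero.mp h₁, sub_eq_zero.mp h₂⟩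

/-- **The four-end moment at a crossing is a sum of two TEAR terms.** With equal weights on the halves of each sheet
(`eq_and_eq_of_pair_balance`) and normals `n₁, n₂, -n₁, -n₂`, the total moment of the four ends based at `a₁, …, a₄` is
`w₁ β(a₁ - a₃, n₁) + w₂ β(a₂ - a₄, n₂)`: only the tears `t₁ = a₁ - a₃`, `t₂ = a₂ - a₄` enter. [folklore] -/
theorem crossing_moment_eq (β : V →ₗ[K] V →ₗ[K] K) (a₁ a₂ a₃ a₄ n₁ n₂ : V) (w₁ w₂ : K) :
    w₁ * β a₁ n₁ + w₂ * β a₂ n₂ + w₁ * β a₃ (-n₁) + w₂ * β a₄ (-n₂)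
      = w₁ * β (a₁ - a₃) n₁ + w₂ * β (a₂ - a₄) n₂ := by
  simp only [map_neg, map_sub, LinearMap.sub_apply]
  ring

/-- The alternating form `x, y ↦ f x * g y - g x * f y` built from two linear functionals (used to probe the hypothesis
"zero moment against EVERY alternating form"). [folklore] -/
theorem wedge_apply (f g : V →ₗ[K] K) (x y : V) :
    (f.smulRight g - g.smulRight f) x y = f x * g y - g x * f y := by
  simp [LinearMap.smulRight_apply, smul_eq_mul]

/-- The form of `wedge_apply` is alternating. [folklore] -/
theorem wedge_self (f g : V →ₗ[K] K) (x : V) : (f.smulRight g - g.smulRight f) x x = 0 := by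
  rw [wedge_apply]; ring

/-- A linear functional vanishing on `K ∙ n₂` and not on `n₁` exists when `n₁, n₂` are independent. [folklore] -/
theorem exists_dual_eq_zero_ne_zero (n₁ n₂ : V) (hn : LinearIndependent K ![n₁, n₂]) :
    ∃ g : Module.Dual K V, g n₁ ≠ 0 ∧ g n₂ = 0 := by
  have hmem : n₁ ∉ (K ∙ n₂) := by
    intro h
    obtain ⟨s, hs⟩ := Submodule.mem_span_singleton.mp h
    have h0 : (1 : K) • n₁ + (-s) • n₂ = 0 := by rw [one_smul, neg_smul, ← hs, add_neg_cancel]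
    exact one_ne_zero ((LinearIndependent.pair_iff.mp hn) 1 (-s) h0).1
  obtain ⟨g, hg₁, hg₂⟩ := Submodule.exists_dual_map_eq_bot_of_notMem hmem inferInstance
  refine ⟨g, hg₁, ?_⟩
  have : g n₂ ∈ (K ∙ n₂).map g := Submodule.mem_map_of_mem (Submodule.mem_span_singleton_self n₂)
  rw [hg₂] at this
  exact (Submodule.mem_bot K).mp this

/-- **At a crossing the tears lie in the plane of the normals.** If `w₁ ≠ 0` and the crossing moment
`w₁ β(t₁, n₁) + w₂ β(t₂, n₂)` vanishes for EVERY alternating bilinear form `β` (as it does for the rescaled limit of a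
constant-type family, by the moment identity), then `t₁ ∈ K n₁ + K n₂` (and symmetrically `t₂`, by
`mem_span_pair_of_crossing_moment'`). Proof: otherwise probe with `β = f ∧ g`, `f` killing `n₁, n₂` but not `t₁`,
`g` killing `n₂` but not `n₁`. (HOME `certificates/splitrigidity` §10 (P5)(i): "tear vectors lie in the sum of the two
spans".) [folklore] -/
theorem mem_span_pair_of_crossing_moment (n₁ n₂ t₁ t₂ : V) (hn : LinearIndependent K ![n₁, n₂]) (w₁ w₂ : K)
    (hw₁ : w₁ ≠ 0)
    (hmom : ∀ β : V →ₗ[K] V →ₗ[K] K, (∀ x, β x x = 0) → w₁ * β t₁ n₁ + w₂ * β t₂ n₂ = 0) :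
    t₁ ∈ Submodule.span K ({n₁, n₂} : Set V) := by
  by_contra ht
  obtain ⟨f, hf₁, hf₂⟩ := Submodule.exists_dual_map_eq_bot_of_notMem ht inferInstance
  have hf : ∀ x ∈ Submodule.span K ({n₁, n₂} : Set V), f x = 0 := by
    intro x hx
    have : f x ∈ (Submodule.span K ({n₁, n₂} : Set V)).map f := Submodule.mem_map_of_mem hx
    rw [hf₂] at this
    exact (Submodule.mem_bot K).mp this
  have hfn₁ : f n₁ = 0 := hf n₁ (Submodule.subset_span (by simp))
  have hfn₂ : f n₂ = 0 := hf n₂ (Submodule.subset_span (by simp))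
  obtain ⟨g, hg₁, hg₂⟩ := exists_dual_eq_zero_ne_zero n₁ n₂ hn
  have key := hmom (f.smulRight g - g.smulRight f) (wedge_self f g)
  rw [wedge_apply, wedge_apply, hfn₁, hfn₂, hg₂] at key
  have : w₁ * (f t₁ * g n₁) = 0 := by linear_combination key
  rcases mul_eq_zero.mp this with h | h
  · exact hw₁ h
  · rcases mul_eq_zero.mp h with h' | h'
    · exact hf₁ h'
    · exact hg₁ h'

/-- The symmetric statement for the second sheet: `t₂ ∈ K n₁ + K n₂` (swap the roles of the two sheets). [folklore] -/
theorem mem_span_pair_of_crossing_moment' (n₁ n₂ t₁ t₂ : V) (hn : LinearIndependent K ![n₁, n₂]) (w₁ w₂ : K)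
    (hw₂ : w₂ ≠ 0)
    (hmom : ∀ β : V →ₗ[K] V →ₗ[K] K, (∀ x, β x x = 0) → w₁ * β t₁ n₁ + w₂ * β t₂ n₂ = 0) :
    t₂ ∈ Submodule.span K ({n₁, n₂} : Set V) := by
  have hn' : LinearIndependent K ![n₂, n₁] := by
    rw [LinearIndependent.pair_iff] at hn ⊢
    intro s t h
    have := hn t s (by rw [← h]; abel)
    exact ⟨this.2, this.1⟩
  have hmom' : ∀ β : V →ₗ[K] V →ₗ[K] K, (∀ x, β x x = 0) → w₂ * β t₂ n₂ + w₁ * β t₁ n₁ = 0 := by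
    intro β hβ; rw [add_comm]; exact hmom β hβ
  have h := mem_span_pair_of_crossing_moment n₂ n₁ t₂ t₁ hn' w₂ w₁ hw₂ hmom'
  have hset : ({n₂, n₁} : Set V) = {n₁, n₂} := Set.pair_comm n₂ n₁
  rw [hset] at h
  exact h

/-- From `β x x = 0` for all `x`: `β` is antisymmetric. [folklore] -/
theorem apply_eq_neg_apply_of_alternating (β : V →ₗ[K] V →ₗ[K] K) (hβ : ∀ x, β x x = 0) (x y : V) :
    β x y = -β y x := by
  have h := hβ (x + y)
  simp only [map_add, LinearMap.add_apply, hβ x, hβ y, zero_add, add_zero] at h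
  linear_combination h

/-- **The tears at a crossing are COUPLED.** If the tears lie in the plane of the normals — `t₁ = a • n₂ + s₁ • n₁`,
`t₂ = c • n₁ + s₂ • n₂` (`mem_span_pair_of_crossing_moment`) — and the crossing moment vanishes for every alternating `β`,
then `w₁ a = w₂ c`: probing with `β = f ∧ g`, `f n₂ = 0 ≠ f n₁`, `g n₁ = 0 ≠ g n₂`, the moment is `(w₂ c − w₁ a) f(n₁) g(n₂)`.
This is the node-resolution coupling `W_P·β = W_{P′}·γ` between the tear of one sheet and the tear of the other
(HOME `certificates/splitrigidity` §10 (P5)(ii), §11): one free parameter per crossing, whose sign selects one of the two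
resolutions of the crossing (dually: a diagonal of the rectangle). [folklore] -/
theorem mul_eq_mul_of_crossing_moment (n₁ n₂ : V) (hn : LinearIndependent K ![n₁, n₂]) (w₁ w₂ a c s₁ s₂ : K)
    (hmom : ∀ β : V →ₗ[K] V →ₗ[K] K, (∀ x, β x x = 0) →
      w₁ * β (a • n₂ + s₁ • n₁) n₁ + w₂ * β (c • n₁ + s₂ • n₂) n₂ = 0) :
    w₁ * a = w₂ * c := by
  obtain ⟨g, hg₁, hg₂⟩ := exists_dual_eq_zero_ne_zero n₁ n₂ hn
  have hn' : LinearIndependent K ![n₂, n₁] := by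
    rw [LinearIndependent.pair_iff] at hn ⊢
    intro s t h
    have := hn t s (by rw [← h]; abel)
    exact ⟨this.2, this.1⟩
  obtain ⟨f, hf₁, hf₂⟩ := exists_dual_eq_zero_ne_zero n₂ n₁ hn'
  -- `f n₂ ≠ 0`, `f n₁ = 0`, `g n₁ ≠ 0`, `g n₂ = 0`
  have key := hmom (f.smulRight g - g.smulRight f) (wedge_self f g)
  rw [wedge_apply, wedge_apply] at key
  simp only [map_add, map_smul, smul_eq_mul, hf₂, hg₂] at key
  have : (w₁ * a - w₂ * c) * (f n₂ * g n₁) = 0 := by linear_combination key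
  rcases mul_eq_zero.mp this with h | h
  · exact sub_eq_zero.mp h
  · rcases mul_eq_zero.mp h with h' | h'
    · exact absurd h' hf₁
    · exact absurd h' hg₁

/-- **Converse: coupled in-plane tears have zero moment** — so the moment identity imposes NOTHING beyond
`mem_span_pair_of_crossing_moment` and `mul_eq_mul_of_crossing_moment` at a crossing: in particular no concurrency and no
relation between the transverse offsets of the two sheets (contrast the trivalent case, `third_line_moment_eq_zero`).
[folklore] -/
theorem crossing_moment_of_coupled (β : V →ₗ[K] V →ₗ[K] K) (hβ : ∀ x, β x x = 0) (n₁ n₂ : V)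
    (w₁ w₂ a c s₁ s₂ : K) (hc : w₁ * a = w₂ * c) :
    w₁ * β (a • n₂ + s₁ • n₁) n₁ + w₂ * β (c • n₁ + s₂ • n₂) n₂ = 0 := by
  simp only [map_add, map_smul, LinearMap.add_apply, LinearMap.smul_apply, smul_eq_mul, hβ n₁, hβ n₂, mul_zero,
    add_zero]
  rw [apply_eq_neg_apply_of_alternating β hβ n₂ n₁]
  linear_combination (-(β n₁ n₂)) * hc

end Summit.HodgeConjecture.HodgeConjecture.Theorems.TropicalWeilVanishing.SplitRigidity.Crossing
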